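import Literature.MathematicalPhysics.QuantumLattice.FlatBandFerromagnetismLineGraph
import Literature.MathematicalPhysics.QuantumLattice.KagomeLattice
import Literature.MathematicalPhysics.QuantumLattice.HubbardModel
import HarnessLib

/-!
# Flat-band ferromagnetism of the Hubbard model on the kagomé torus (Mielke 1992)

Topic `MathematicalPhysics/QuantumLattice` (Hubbard family; rigorous ferromagnetism). The kagomé
instance of Mielke's flat-band ferromagnetism on line graphs (`FlatBandFerromagnetismLineGraph.lean`,
[Tasaki 1998, §6.5, Theorem 6.2]: "This theorem applies to the Hubbard model defined on various line
graphs, a typical one being the kagomé lattice"; the original is [Mielke 1992], [Mielke 1991b]).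

**Setting.** The kagomé torus with `L × L` unit cells is the tree's `kagomeTorusGraph L` on
`KagomeTorusVertex L = TorusSite 2 L × Fin 3` [Savary–Balents 2017, §5]. The Jordan–Wigner fermion
operators of `HubbardWave0` need a linear order on the sites, so — exactly as `FermionTorus d L`
versus `TorusSite d L` in `HubbardModel.lean` — we use FERMIONIC COORDINATES
`KagomeFermionVertex L = FermionTorus 2 L ×ₗ Fin 3` with the comparison bijection
`KagomeFermionVertex.equivKagomeTorusVertex` and the pulled-back graph `kagomeFermionGraph L`
(isomorphic to `kagomeTorusGraph L`, `kagomeFermionGraphIso`). The Hubbard Hamiltonian is the tree's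
`hamiltonian (kagomeFermionGraph L) t U = -t Σ_{⟨ab⟩,σ} c†_{aσ}c_{bσ} + U Σ_a n_{a↑}n_{a↓}`; Mielke's
convention `H = t Σ c†c + …` with `t > 0` is the tree's parameter `-t`.

**The kagomé torus is the line graph of the honeycomb torus.** The honeycomb (hexagonal) torus has
vertices `HexTorusVertex L = TorusSite 2 L × Fin 2` — `(X, 0)` the up-triangle `{X, X+e₀, X+e₁}` and
`(X, 1)` the down-triangle `{X+e₀, X+e₁, X+e₀+e₁}` of the triangular torus, the convention of the
tree's planar `HexVertex` — and its edges are the kagomé sites: the site `(X, s)` (midpoint of the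
triangular edge `kagomeEdge`) separates the up-triangle of `X` from the down-triangle of `X - δ_s`,
`δ = (e₁, e₀, 0)` (`hexEdge`, `kagomeEd`). Two distinct kagomé sites are adjacent in `kagomeTorusGraph L`
iff their honeycomb edges share a vertex (`exists_mem_hexEdge_iff`, all `L`), so the line-graph
Hamiltonian of `FlatBandFerromagnetismLineGraph.lean` for the labelling `kagomeEd` IS the kagomé Hubbard
Hamiltonian (`lineGraphHamiltonian_kagomeEd`). For `L ≥ 2` the labelling is injective, the honeycomb
torus is connected and bipartite with `2L²` vertices and `3L²` edges, so the flat band (lowest kagomé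
band, energy `-2t`) has dimension `M = 3L² - 2L² + 1 = L² + 1` (`finrank_kagome_flatBand`); the
hexagon states (alternating signs around the six triangles at a vertex of the triangular torus,
`hexVec`) are indecomposable flat-band vectors covering every site with connected overlaps, whence
Mielke's irreducibility (`kagome_flatBand_isIrreducible`, via `isIrreducible_of_cover`).

**Theorem (`kagome_flatBand_ferromagnetism`) [Mielke 1992; Tasaki 1998, Theorem 6.2].** For `L ≥ 2`,
`t > 0`, `U > 0` and `N_e = L² + 1` electrons on the `3L²`-site kagomé torus, the ground-state energy
of `hamiltonian (kagomeFermionGraph L) (-t) U` is `-2t (L² + 1)`, every ground state has total spin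
`S = N_e/2` (`S² ψ = S(S+1) ψ`), and the ground states form exactly one spin multiplet (dimension
`N_e + 1 = L² + 2` of the joint eigenspace). All statements are proved; no named facts.

## References

* A. Mielke, *Exact ground states for the Hubbard model on the Kagome lattice*, J. Phys. A **25**
  (1992) 4335–4345 [Mielke1992]; *Ferromagnetism in the Hubbard model on line graphs and further
  considerations*, J. Phys. A **24** (1991) 3311–3321 [Mielke1991b].
* H. Tasaki, Prog. Theor. Phys. **99** (1998) 489 = arXiv:cond-mat/9712219, §6.5, Theorem 6.2 and
  the kagomé remark following it [Tasaki1998PTP] (held text p. 22).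
* L. Savary, L. Balents, Rep. Prog. Phys. **80** (2017) 016502, §5 (kagomé conventions of
  `KagomeLattice.lean`) [SavaryBalents2017].
-/

noncomputable section

open Matrix Finset Module Literature.Probability.LatticeModels
open scoped ComplexOrder

namespace Literature.MathematicalPhysics.QuantumLattice

/-! ### Fermionic coordinates on the kagomé torus -/

/-- The sites of the kagomé torus with `L × L` unit cells in fermionic coordinates: a cell of the
fermionic torus `FermionTorus 2 L = Lex (Fin 2 → Fin L)` and a sublattice index `s : Fin 3`, in
lexicographic order (the Jordan–Wigner construction needs a `LinearOrder`); compare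
`KagomeTorusVertex L = TorusSite 2 L × Fin 3`. [cite: SavaryBalents2017, §5] -/
abbrev KagomeFermionVertex (L : ℕ) : Type := FermionTorus 2 L ×ₗ Fin 3

namespace KagomeFermionVertex

variable {L : ℕ}

/-- The comparison map to `KagomeTorusVertex L`: reduce the cell via `FermionTorus.toTorusSite`,
keep the sublattice index. [cite: SavaryBalents2017, §5] -/
def toKagomeTorusVertex (a : KagomeFermionVertex L) : KagomeTorusVertex L :=
  (FermionTorus.toTorusSite (ofLex a).1, (ofLex a).2)

/-- The inverse comparison map (canonical representatives, `L ≠ 0`). [cite: SavaryBalents2017, §5] -/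
def ofKagomeTorusVertex [NeZero L] (b : KagomeTorusVertex L) : KagomeFermionVertex L :=
  toLex (FermionTorus.ofTorusSite b.1, b.2)

/-- `toKagomeTorusVertex ∘ ofKagomeTorusVertex = id`. [cite: SavaryBalents2017, §5] -/
@[simp] theorem toKagomeTorusVertex_ofKagomeTorusVertex [NeZero L] (b : KagomeTorusVertex L) :
    toKagomeTorusVertex (ofKagomeTorusVertex b) = b := by
  simp [toKagomeTorusVertex, ofKagomeTorusVertex]

/-- `ofKagomeTorusVertex ∘ toKagomeTorusVertex = id`. [cite: SavaryBalents2017, §5] -/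
@[simp] theorem ofKagomeTorusVertex_toKagomeTorusVertex [NeZero L] (a : KagomeFermionVertex L) :
    ofKagomeTorusVertex (toKagomeTorusVertex a) = a := by
  simp [toKagomeTorusVertex, ofKagomeTorusVertex]

/-- The comparison maps assemble to a bijection `KagomeFermionVertex L ≃ KagomeTorusVertex L`
(`L ≠ 0`). [cite: SavaryBalents2017, §5] -/
def equivKagomeTorusVertex [NeZero L] : KagomeFermionVertex L ≃ KagomeTorusVertex L where
  toFun := toKagomeTorusVertex
  invFun := ofKagomeTorusVertex
  left_inv := ofKagomeTorusVertex_toKagomeTorusVertex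
  right_inv := toKagomeTorusVertex_ofKagomeTorusVertex

/-- `toKagomeTorusVertex` is injective (`L ≠ 0`). [cite: SavaryBalents2017, §5] -/
theorem toKagomeTorusVertex_injective [NeZero L] :
    Function.Injective (toKagomeTorusVertex (L := L)) :=
  (equivKagomeTorusVertex (L := L)).injective

/-- `ofKagomeTorusVertex` is injective. [cite: SavaryBalents2017, §5] -/
theorem ofKagomeTorusVertex_injective [NeZero L] :
    Function.Injective (ofKagomeTorusVertex (L := L)) :=
  (equivKagomeTorusVertex (L := L)).symm.injective

/-- The fermionic kagomé torus has `3 L²` sites. [cite: SavaryBalents2017, §5] -/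
theorem card_eq [NeZero L] : Fintype.card (KagomeFermionVertex L) = 3 * L ^ 2 := by
  rw [Fintype.card_congr (equivKagomeTorusVertex (L := L)), card_kagomeTorusVertex]

end KagomeFermionVertex

/-- The kagomé torus graph in fermionic coordinates: the pull-back of `kagomeTorusGraph L` along
`KagomeFermionVertex.toKagomeTorusVertex` (an `abbrev`, so that Mathlib's decidability instance for
`SimpleGraph.comap` applies, as `hamiltonian` requires). [cite: SavaryBalents2017, §5] -/
abbrev kagomeFermionGraph (L : ℕ) : SimpleGraph (KagomeFermionVertex L) :=
  (kagomeTorusGraph L).comap KagomeFermionVertex.toKagomeTorusVertex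

/-- Adjacency in fermionic coordinates is adjacency of the images in `kagomeTorusGraph L`.
[cite: SavaryBalents2017, §5] -/
theorem kagomeFermionGraph_adj {L : ℕ} (a b : KagomeFermionVertex L) :
    (kagomeFermionGraph L).Adj a b ↔
      (kagomeTorusGraph L).Adj (KagomeFermionVertex.toKagomeTorusVertex a)
        (KagomeFermionVertex.toKagomeTorusVertex b) := Iff.rfl

/-- `kagomeFermionGraph L` is isomorphic to the tree's `kagomeTorusGraph L` (`L ≠ 0`).
[cite: SavaryBalents2017, §5] -/
def kagomeFermionGraphIso (L : ℕ) [NeZero L] : kagomeFermionGraph L ≃g kagomeTorusGraph L :=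
  { toEquiv := KagomeFermionVertex.equivKagomeTorusVertex, map_rel_iff' := Iff.rfl }

namespace FlatBand

variable {L : ℕ}

/-! ### The honeycomb torus and its edge labelling by kagomé sites -/

/-- The vertices of the honeycomb (hexagonal) torus = the triangular faces of the triangular torus:
`(X, 0)` is the up-triangle `{X, X+e₀, X+e₁}`, `(X, 1)` the down-triangle `{X+e₀, X+e₁, X+e₀+e₁}`
(the convention of the planar `HexVertex`). [cite: SavaryBalents2017, §5] -/
abbrev HexTorusVertex (L : ℕ) : Type := TorusSite 2 L × Fin 2

variable (L) in
/-- The cell offset `δ_s = (e₁, e₀, 0)_s` of the down-triangle bordering the kagomé site `(X, s)`: the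
site `(X, 0)` (midpoint of `{X, X+e₀}`) borders the down-triangle of the cell `X - e₁`, `(X, 1)`
(midpoint of `{X, X+e₁}`) that of `X - e₀`, `(X, 2)` (midpoint of `{X+e₀, X+e₁}`) that of `X`.
[cite: SavaryBalents2017, §5, Fig. 12] -/
def kagomeDownShift (s : Fin 3) : TorusSite 2 L := ![Pi.single 1 1, Pi.single 0 1, 0] s

/-- The honeycomb edge bisected by the kagomé site `(X, s)`: it joins the up-triangle of `X` to the
down-triangle of `X - δ_s` (kagomé sites = edges of the honeycomb lattice = edges of `𝕋`).
[cite: SavaryBalents2017, §5] [cite: Tasaki1998PTP, §6.5 (the kagomé lattice as a line graph)] -/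
def hexEdge (b : KagomeTorusVertex L) : Sym2 (HexTorusVertex L) :=
  s((b.1, 0), (b.1 - kagomeDownShift L b.2, 1))

/-- The labelling of the edges of the honeycomb torus by the fermionic kagomé sites, `ed = hexEdge ∘
toKagomeTorusVertex` (the `ed` of `FlatBandFerromagnetismLineGraph.lean`). [cite: Tasaki1998PTP, §6.5] -/
def kagomeEd (a : KagomeFermionVertex L) : Sym2 (HexTorusVertex L) :=
  hexEdge (KagomeFermionVertex.toKagomeTorusVertex a)

/-- `kagomeEd ∘ ofKagomeTorusVertex = hexEdge`. [cite: Tasaki1998PTP, §6.5] -/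
theorem kagomeEd_ofKagomeTorusVertex [NeZero L] (b : KagomeTorusVertex L) :
    kagomeEd (KagomeFermionVertex.ofKagomeTorusVertex b) = hexEdge b := by
  rw [kagomeEd, KagomeFermionVertex.toKagomeTorusVertex_ofKagomeTorusVertex]

/-- Honeycomb edges are not loops (they join an up- to a down-triangle). [cite: Tasaki1998PTP, §6.5] -/
theorem hexEdge_not_isDiag (b : KagomeTorusVertex L) : ¬ (hexEdge b).IsDiag := by
  rw [hexEdge, Sym2.mk_isDiag_iff]
  exact fun h => zero_ne_one (congrArg Prod.snd h : ((0 : Fin 2)) = 1)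

/-- `kagomeEd` has no loops. [cite: Tasaki1998PTP, §6.5] -/
theorem kagomeEd_not_isDiag (a : KagomeFermionVertex L) : ¬ (kagomeEd a).IsDiag :=
  hexEdge_not_isDiag _

/-- One direction of the line-graph description: table-adjacent kagomé sites bisect honeycomb edges
with a common vertex. [cite: SavaryBalents2017, §5, Fig. 12] [cite: Tasaki1998PTP, §6.5] -/
theorem exists_mem_hexEdge_of_kagomeAdjRel {a b : KagomeTorusVertex L} (h : KagomeAdjRel (ZMod L) a b) :
    ∃ v, v ∈ hexEdge a ∧ v ∈ hexEdge b := by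
  obtain ⟨xa, sa⟩ := a
  obtain ⟨xb, sb⟩ := b
  rcases h with ⟨h1, -⟩ | ⟨h1, h2, h3⟩ | ⟨h1, h2, h3⟩ | ⟨h1, h2, h3⟩ <;> dsimp only at h1
  · refine ⟨(xa, 0), Sym2.mem_mk_left _ _, ?_⟩
    rw [hexEdge, h1]
    exact Sym2.mem_mk_left _ _
  · dsimp only at h2 h3; subst h1 h2 h3
    exact ⟨(xa, 1), by simp [hexEdge, kagomeDownShift], by simp [hexEdge, kagomeDownShift]⟩
  · dsimp only at h2 h3; subst h1 h2 h3
    exact ⟨(xa, 1), by simp [hexEdge, kagomeDownShift], by simp [hexEdge, kagomeDownShift]⟩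
  · dsimp only at h2 h3; subst h1 h2 h3
    exact ⟨(xa - Pi.single 0 1, 1), by simp [hexEdge, kagomeDownShift],
      by simp [hexEdge, kagomeDownShift]⟩

/-- **The kagomé torus is the line graph of the honeycomb torus**: two distinct kagomé sites are
adjacent in `kagomeTorusGraph L` iff their honeycomb edges share a vertex (valid for every `L`).
[cite: SavaryBalents2017, §5 ("the kagome lattice is the medial lattice of the triangular/honeycomb
lattice")] [cite: Tasaki1998PTP, §6.5 (the kagomé lattice as a line graph)] -/
theorem exists_mem_hexEdge_iff (a b : KagomeTorusVertex L) :
    (a ≠ b ∧ ∃ v, v ∈ hexEdge a ∧ v ∈ hexEdge b) ↔ (kagomeTorusGraph L).Adj a b := by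
  rw [kagomeTorusGraph_adj_iff]
  refine and_congr_right fun hab => ⟨fun ⟨v, hva, hvb⟩ => ?_, fun h => h.elim
    exists_mem_hexEdge_of_kagomeAdjRel fun h =>
      let ⟨v, h1, h2⟩ := exists_mem_hexEdge_of_kagomeAdjRel h; ⟨v, h2, h1⟩⟩
  obtain ⟨xa, sa⟩ := a
  obtain ⟨xb, sb⟩ := b
  rw [hexEdge, Sym2.mem_iff] at hva hvb
  dsimp only at hva hvb
  rcases hva with rfl | rfl <;> rcases hvb with h | h
  · have hx : xa = xb := congrArg Prod.fst h
    subst hx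
    exact Or.inl (Or.inl ⟨rfl, fun hs => hab (congrArg (Prod.mk xa) hs)⟩)
  · exact absurd (congrArg Prod.snd h : ((0 : Fin 2)) = 1) zero_ne_one
  · exact absurd (congrArg Prod.snd h : ((1 : Fin 2)) = 0) one_ne_zero
  · have hx : xa - kagomeDownShift L sa = xb - kagomeDownShift L sb := congrArg Prod.fst h
    have hx' : xb = xa - kagomeDownShift L sa + kagomeDownShift L sb := by rw [hx, sub_add_cancel]
    fin_cases sa <;> fin_cases sb <;> simp [kagomeDownShift] at hx' <;> subst hx' <;>
      first | exact absurd rfl hab | simp [KagomeAdjRel]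

variable [NeZero L]

/-- The line-graph hopping of the labelling `kagomeEd` is `t` times the adjacency of the kagomé
torus. [cite: Tasaki1998PTP, §6.5] [cite: Mielke1992] -/
theorem lineHopping_kagomeEd (t : ℝ) (a b : KagomeFermionVertex L) :
    lineHopping kagomeEd t a b = if (kagomeFermionGraph L).Adj a b then t else 0 := by
  rw [lineHopping]
  have key : (a ≠ b ∧ ∃ v, v ∈ kagomeEd a ∧ v ∈ kagomeEd b) ↔ (kagomeFermionGraph L).Adj a b := by
    rw [kagomeFermionGraph_adj, ← exists_mem_hexEdge_iff,
      KagomeFermionVertex.toKagomeTorusVertex_injective.ne_iff]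
    rfl
  by_cases h : (kagomeFermionGraph L).Adj a b
  · rw [if_pos h, if_pos (key.2 h)]
  · rw [if_neg h, if_neg (fun h' => h (key.1 h'))]

/-- **The kagomé Hubbard Hamiltonian is a line-graph Hamiltonian**: Mielke's
`t Σ_{⟨ab⟩,σ} c†_{aσ}c_{bσ} + U Σ n_{a↑}n_{a↓}` on `L`(honeycomb torus) is the tree's
`hamiltonian (kagomeFermionGraph L) (-t) U`. [cite: Tasaki1998PTP, §6.5 (the display defining `H` on
`L(G)`)] [cite: Mielke1992] -/
theorem lineGraphHamiltonian_kagomeEd (t U : ℝ) :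
    lineGraphHamiltonian (kagomeEd (L := L)) t U = QuantumLattice.hamiltonian (kagomeFermionGraph L) (-t) U := by
  rw [lineGraphHamiltonian, QuantumLattice.hamiltonian, hoppingOp, onSiteRepulsion, Complex.ofReal_neg,
    neg_neg]
  congr 1
  rw [Finset.smul_sum]
  refine sum_congr rfl fun x _ => ?_
  rw [Finset.smul_sum]
  refine sum_congr rfl fun y _ => ?_
  rw [Finset.smul_sum]
  refine sum_congr rfl fun σ _ => ?_
  rw [lineHopping_kagomeEd]
  split_ifs <;> simp

/-! ### `L ≥ 2`: injectivity, connectivity, the flat-band dimension `L² + 1` -/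

omit [NeZero L] in
/-- `1 ≠ 0` in `ZMod L` for `L ≥ 2`. [folklore] -/
private theorem one_ne_zero_zmod (hL : 2 ≤ L) : (1 : ZMod L) ≠ 0 := by
  haveI : Fact (1 < L) := ⟨hL⟩
  exact one_ne_zero

omit [NeZero L] in
/-- `e₀ ≠ 0` on the torus `(ℤ/L)²`, `L ≥ 2`. [folklore] -/
private theorem e0_ne_zero (hL : 2 ≤ L) : (Pi.single 0 1 : TorusSite 2 L) ≠ 0 := fun h =>
  one_ne_zero_zmod hL (by simpa using congrFun h 0)

omit [NeZero L] in
/-- `e₁ ≠ 0` on the torus `(ℤ/L)²`, `L ≥ 2`. [folklore] -/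
private theorem e1_ne_zero (hL : 2 ≤ L) : (Pi.single 1 1 : TorusSite 2 L) ≠ 0 := fun h =>
  one_ne_zero_zmod hL (by simpa using congrFun h 1)

omit [NeZero L] in
/-- `e₀ ≠ e₁` on the torus `(ℤ/L)²`, `L ≥ 2`. [folklore] -/
private theorem e0_ne_e1 (hL : 2 ≤ L) : (Pi.single 0 1 : TorusSite 2 L) ≠ Pi.single 1 1 := fun h =>
  one_ne_zero_zmod hL (by simpa using congrFun h 0)

omit [NeZero L] in
/-- The three down-shifts `e₁, e₀, 0` are distinct for `L ≥ 2`. [cite: SavaryBalents2017, §5] -/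
theorem kagomeDownShift_injective (hL : 2 ≤ L) : Function.Injective (kagomeDownShift L) := by
  intro s s' h
  fin_cases s <;> fin_cases s' <;>
    first | rfl | (exfalso; simp [kagomeDownShift, e0_ne_zero hL, e1_ne_zero hL, e0_ne_e1 hL,
      (e0_ne_e1 hL).symm, (e0_ne_zero hL).symm, (e1_ne_zero hL).symm] at h)

omit [NeZero L] in
/-- Distinct kagomé sites bisect distinct honeycomb edges (`L ≥ 2`; for `L = 1` the three sites
coincide as edges). [cite: SavaryBalents2017, §5] -/
theorem hexEdge_injective (hL : 2 ≤ L) : Function.Injective (hexEdge (L := L)) := by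
  rintro ⟨x, s⟩ ⟨x', s'⟩ h
  rw [hexEdge, hexEdge, Sym2.eq_iff] at h
  rcases h with ⟨h1, h2⟩ | ⟨h1, -⟩
  · have hx : x = x' := congrArg Prod.fst h1
    have hd : x - kagomeDownShift L s = x' - kagomeDownShift L s' := congrArg Prod.fst h2
    subst hx
    rw [sub_right_inj] at hd
    rw [kagomeDownShift_injective hL hd]
  · exact absurd (congrArg Prod.snd h1 : ((0 : Fin 2)) = 1) zero_ne_one

/-- The labelling `kagomeEd` is injective (`L ≥ 2`). [cite: Tasaki1998PTP, §6.5] -/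
theorem kagomeEd_injective (hL : 2 ≤ L) : Function.Injective (kagomeEd (L := L)) :=
  (hexEdge_injective hL).comp KagomeFermionVertex.toKagomeTorusVertex_injective

/-- An explicit labelled edge gives an adjacency of the honeycomb torus `edGraph kagomeEd`.
[cite: Tasaki1998PTP, §6.5] -/
private theorem adj_of_hexEdge_eq {v w : HexTorusVertex L} (hvw : v ≠ w) (b : KagomeTorusVertex L)
    (h : hexEdge b = s(v, w)) : (edGraph (kagomeEd (L := L))).Adj v w :=
  edGraph_adj_iff.2 ⟨hvw, KagomeFermionVertex.ofKagomeTorusVertex b,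
    by rw [kagomeEd_ofKagomeTorusVertex, h]⟩

/-- The up-triangle of `X` is adjacent to the down-triangle of `X` (across the site `(X, 2)`).
[cite: SavaryBalents2017, §5, Fig. 12] -/
theorem hexTorus_adj_up_down (X : TorusSite 2 L) :
    (edGraph (kagomeEd (L := L))).Adj ((X, 0) : HexTorusVertex L) (X, 1) :=
  adj_of_hexEdge_eq (by simp) (X, 2) (by simp [hexEdge, kagomeDownShift])

/-- The up-triangle of `X + e₀` is adjacent to the down-triangle of `X` (across the site `(X+e₀, 1)`).
[cite: SavaryBalents2017, §5, Fig. 12] -/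
theorem hexTorus_adj_up_e0_down (X : TorusSite 2 L) :
    (edGraph (kagomeEd (L := L))).Adj ((X + Pi.single 0 1, 0) : HexTorusVertex L) (X, 1) :=
  adj_of_hexEdge_eq (by simp) (X + Pi.single 0 1, 1) (by simp [hexEdge, kagomeDownShift])

/-- The up-triangle of `X + e₁` is adjacent to the down-triangle of `X` (across the site `(X+e₁, 0)`).
[cite: SavaryBalents2017, §5, Fig. 12] -/
theorem hexTorus_adj_up_e1_down (X : TorusSite 2 L) :
    (edGraph (kagomeEd (L := L))).Adj ((X + Pi.single 1 1, 0) : HexTorusVertex L) (X, 1) :=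
  adj_of_hexEdge_eq (by simp) (X + Pi.single 1 1, 0) (by simp [hexEdge, kagomeDownShift])

omit [NeZero L] in
/-- Coordinates on `(ℤ/L)²`: `d = d₀ e₀ + d₁ e₁`. [folklore] -/
private theorem torusSite_two_eq (d : TorusSite 2 L) :
    d = Pi.single 0 (d 0) + Pi.single 1 (d 1) := by
  funext k
  fin_cases k <;> simp

/-- A relation on `(ℤ/L)²` containing the steps `X → X + e₀`, `X → X + e₁` has total
reflexive-transitive closure. [folklore] -/
private theorem reflTransGen_torusSite {r : TorusSite 2 L → TorusSite 2 L → Prop}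
    (h0 : ∀ X, r X (X + Pi.single 0 1)) (h1 : ∀ X, r X (X + Pi.single 1 1)) (X Y : TorusSite 2 L) :
    Relation.ReflTransGen r X Y := by
  have hm : ∀ X (m : ℕ), Relation.ReflTransGen r X (X + Pi.single 0 ((m : ℕ) : ZMod L)) := by
    intro X m
    induction m with
    | zero => rw [Nat.cast_zero, Pi.single_zero, add_zero]
    | succ m ih => rw [Nat.cast_succ, Pi.single_add, ← add_assoc]; exact ih.tail (h0 _)
  have hn : ∀ X (n : ℕ), Relation.ReflTransGen r X (X + Pi.single 1 ((n : ℕ) : ZMod L)) := by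
    intro X n
    induction n with
    | zero => rw [Nat.cast_zero, Pi.single_zero, add_zero]
    | succ n ih => rw [Nat.cast_succ, Pi.single_add, ← add_assoc]; exact ih.tail (h1 _)
  obtain ⟨m, n, hmn⟩ : ∃ m n : ℕ,
      Y = X + Pi.single 0 ((m : ℕ) : ZMod L) + Pi.single 1 ((n : ℕ) : ZMod L) := by
    refine ⟨((Y - X) 0).val, ((Y - X) 1).val, ?_⟩
    rw [ZMod.natCast_zmod_val, ZMod.natCast_zmod_val, add_assoc, ← torusSite_two_eq (Y - X),
      add_sub_cancel]
  rw [hmn]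
  exact (hm X m).trans (hn _ n)

/-- **The honeycomb torus is connected.** [cite: SavaryBalents2017, §5] -/
theorem hexTorus_connected : (edGraph (kagomeEd (L := L))).Connected := by
  have hup : ∀ X Y : TorusSite 2 L,
      (edGraph (kagomeEd (L := L))).Reachable ((X, 0) : HexTorusVertex L) (Y, 0) := by
    intro X Y
    have h := reflTransGen_torusSite
      (r := fun X Y : TorusSite 2 L => (edGraph (kagomeEd (L := L))).Reachable (X, 0) (Y, 0))
      (fun X => (hexTorus_adj_up_down X).reachable.trans (hexTorus_adj_up_e0_down X).reachable.symm)
      (fun X => (hexTorus_adj_up_down X).reachable.trans (hexTorus_adj_up_e1_down X).reachable.symm) X Y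
    induction h with
    | refl => rfl
    | tail _ hbc ih => exact ih.trans hbc
  have h0 : ∀ v : HexTorusVertex L, (edGraph (kagomeEd (L := L))).Reachable ((0, 0) : HexTorusVertex L) v := by
    rintro ⟨Y, π⟩
    fin_cases π
    · exact hup 0 Y
    · exact (hup 0 Y).trans (hexTorus_adj_up_down Y).reachable
  exact (SimpleGraph.connected_iff _).2 ⟨fun v w => (h0 v).symm.trans (h0 w), ⟨((0 : TorusSite 2 L), 0)⟩⟩

omit [NeZero L] in
/-- **The honeycomb torus is bipartite**: the sign `+1` on up-, `-1` on down-triangles alternates along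
every edge. [cite: Tasaki1998PTP, §6.5 (`M(G) = |E| - |V| + 1` "if `G` is bipartite")] -/
theorem hexTorus_sign_alternates {v w : HexTorusVertex L} (h : (edGraph (kagomeEd (L := L))).Adj v w) :
    (if v.2 = 0 then (1 : ℝ) else -1) = -(if w.2 = 0 then (1 : ℝ) else -1) := by
  obtain ⟨-, l, hl⟩ := edGraph_adj_iff.1 h
  rw [kagomeEd, hexEdge, Sym2.eq_iff] at hl
  rcases hl with ⟨rfl, rfl⟩ | ⟨rfl, rfl⟩ <;> simp

/-- **The kagomé flat band has dimension `L² + 1`** (`= |E| - |V| + 1 = 3L² - 2L² + 1` for the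
connected bipartite honeycomb torus, `L ≥ 2`). [cite: Tasaki1998PTP, §6.5 (`M(G) = |E| - |V| + 1`)]
[cite: Mielke1992] -/
theorem finrank_kagome_flatBand (hL : 2 ≤ L) :
    finrank ℝ (flatBand (univ : Finset (HexTorusVertex L)) (incVec (kagomeEd (L := L)))) = L ^ 2 + 1 := by
  have h := finrank_flatBand_incVec_add_card (ed := kagomeEd (L := L)) kagomeEd_not_isDiag
    hexTorus_connected (ε := fun v => if v.2 = 0 then (1 : ℝ) else -1)
    (fun v w hvw => hexTorus_sign_alternates hvw) (fun v => by split_ifs <;> norm_num)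
  have hV : Fintype.card (HexTorusVertex L) = L ^ 2 * 2 := by
    simp [Fintype.card_prod, ZMod.card]
  rw [KagomeFermionVertex.card_eq, hV] at h
  have _ := hL
  omega

/-! ### The hexagon states and Mielke's irreducibility -/

/-- The six triangular faces around the vertex `z` of the triangular torus, in cyclic order
(`U(z), D(z-e₀), U(z-e₀), D(z-e₀-e₁), U(z-e₁), D(z-e₁)`): the hexagon of the honeycomb torus dual to
`z`. [cite: Tasaki1998PTP, §6.5 (Figure (f:kagome))] [cite: Mielke1992] -/
def hexFace (z : TorusSite 2 L) : ZMod 6 → HexTorusVertex L :=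
  ![(z, 0), (z - Pi.single 0 1, 1), (z - Pi.single 0 1, 0), (z - (Pi.single 0 1 + Pi.single 1 1), 1),
    (z - Pi.single 1 1, 0), (z - Pi.single 1 1, 1)]

/-- The six kagomé sites around the vertex `z` of the triangular torus (the six edges of `𝕋` at `z`),
in the cyclic order matching `hexFace`. [cite: Tasaki1998PTP, §6.5] [cite: Mielke1992] -/
def hexSite (z : TorusSite 2 L) : ZMod 6 → KagomeTorusVertex L :=
  ![(z, 1), (z - Pi.single 0 1, 2), (z - Pi.single 0 1, 0), (z - Pi.single 1 1, 1),
    (z - Pi.single 1 1, 2), (z, 0)]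

/-- The alternating signs `+1, -1, …` around a hexagon. [cite: Mielke1992] -/
def hexSign : ZMod 6 → ℝ := ![1, -1, 1, -1, 1, -1]

/-- **The hexagon state** around `z`: the flat-band vector `Σ_i (-1)^i δ_{hexSite z i}` (in fermionic
coordinates), an even-cycle vector of the honeycomb torus. [cite: Tasaki1998PTP, §6.5 (flat-band
states localised on hexagons of the kagomé lattice)] [cite: Mielke1992] -/
def hexVec (z : TorusSite 2 L) : KagomeFermionVertex L → ℝ :=
  cycleVec (fun i => KagomeFermionVertex.ofKagomeTorusVertex (hexSite z i)) hexSign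

omit [NeZero L] in
/-- Successor table in `ZMod 6`. [folklore] -/
private theorem zmod6_add_one (i : ZMod 6) : i + 1 = (![1, 2, 3, 4, 5, 0] : ZMod 6 → ZMod 6) i := by
  fin_cases i <;> rfl

omit [NeZero L] in
/-- The signs alternate around the hexagon. [cite: Mielke1992] -/
theorem hexSign_succ (i : ZMod 6) : hexSign (i + 1) = -hexSign i := by
  rw [zmod6_add_one]; fin_cases i <;> simp [hexSign]

omit [NeZero L] in
/-- The signs are nonzero. [cite: Mielke1992] -/
theorem hexSign_ne_zero (i : ZMod 6) : hexSign i ≠ 0 := by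
  fin_cases i <;> simp [hexSign]

omit [NeZero L] in
/-- The `i`-th site around `z` bisects the honeycomb edge between the `i`-th and `(i+1)`-st faces
around `z`: `hexSite z` is a closed walk of length `6` in the honeycomb torus. [cite: Tasaki1998PTP, §6.5]
[cite: Mielke1992] -/
theorem hexEdge_hexSite (z : TorusSite 2 L) (i : ZMod 6) :
    hexEdge (hexSite z i) = s(hexFace z i, hexFace z (i + 1)) := by
  rw [zmod6_add_one]
  fin_cases i <;> simp [hexEdge, hexSite, hexFace, kagomeDownShift, sub_sub, add_comm]

omit [NeZero L] in
/-- `a = a - b ↔ b = 0`. [folklore] -/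
private theorem eq_sub_self_iff {G : Type*} [AddGroup G] (a b : G) : a = a - b ↔ b = 0 := by
  rw [eq_comm, sub_eq_self]

omit [NeZero L] in
/-- The six faces around `z` are distinct (`L ≥ 2`). [cite: Tasaki1998PTP, §6.5] -/
theorem hexFace_injective (hL : 2 ≤ L) (z : TorusSite 2 L) : Function.Injective (hexFace z) := by
  intro i j h
  fin_cases i <;> fin_cases j <;>
    first | rfl | (exfalso; simp [hexFace, Prod.ext_iff, sub_right_inj, eq_sub_self_iff, sub_eq_self,
      e0_ne_zero hL, e1_ne_zero hL, e0_ne_e1 hL, (e0_ne_e1 hL).symm] at h)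

omit [NeZero L] in
/-- The six sites around `z` are distinct (`L ≥ 2`). [cite: Tasaki1998PTP, §6.5] -/
theorem hexSite_injective (hL : 2 ≤ L) (z : TorusSite 2 L) : Function.Injective (hexSite z) := by
  intro i j h
  fin_cases i <;> fin_cases j <;>
    first | rfl | (exfalso; simp [hexSite, Prod.ext_iff, sub_right_inj, eq_sub_self_iff, sub_eq_self,
      e0_ne_zero hL, e1_ne_zero hL, e0_ne_e1 hL, (e0_ne_e1 hL).symm] at h)

/-- The fermionic hexagon cycle is injective (`L ≥ 2`). [cite: Tasaki1998PTP, §6.5] -/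
private theorem hexCycle_injective (hL : 2 ≤ L) (z : TorusSite 2 L) :
    Function.Injective (fun i => KagomeFermionVertex.ofKagomeTorusVertex (hexSite z i)) :=
  KagomeFermionVertex.ofKagomeTorusVertex_injective.comp (hexSite_injective hL z)

/-- The labelled edges along the fermionic hexagon cycle. [cite: Tasaki1998PTP, §6.5] -/
private theorem kagomeEd_hexCycle (z : TorusSite 2 L) (i : ZMod 6) :
    kagomeEd (KagomeFermionVertex.ofKagomeTorusVertex (hexSite z i)) = s(hexFace z i, hexFace z (i + 1)) := by
  rw [kagomeEd_ofKagomeTorusVertex, hexEdge_hexSite]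

/-- **Hexagon states lie in the flat band** (even cycle, alternating signs). [cite: Tasaki1998PTP, §6.5]
[cite: Mielke1992] -/
theorem hexVec_mem_flatBand (hL : 2 ≤ L) (z : TorusSite 2 L) :
    hexVec z ∈ flatBand (univ : Finset (HexTorusVertex L)) (incVec (kagomeEd (L := L))) :=
  cycleVec_mem_flatBand (kagomeEd_hexCycle z) (hexFace_injective hL z) (hexCycle_injective hL z)
    (by norm_num) hexSign_succ

/-- The hexagon state takes the value `±1` on its sites. [cite: Mielke1992] -/
theorem hexVec_apply_hexSite (hL : 2 ≤ L) (z : TorusSite 2 L) (i : ZMod 6) :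
    hexVec z (KagomeFermionVertex.ofKagomeTorusVertex (hexSite z i)) = hexSign i :=
  cycleVec_apply_cycle (s := hexSign) (hexCycle_injective hL z) i

/-- In particular the hexagon state is nonzero on each of its six sites. [cite: Mielke1992] -/
theorem hexVec_apply_hexSite_ne_zero (hL : 2 ≤ L) (z : TorusSite 2 L) (i : ZMod 6) :
    hexVec z (KagomeFermionVertex.ofKagomeTorusVertex (hexSite z i)) ≠ 0 := by
  rw [hexVec_apply_hexSite hL]
  exact hexSign_ne_zero i

/-- **A hexagon state cannot be cut by a coordinate splitting of the flat band.** [cite: Mielke1999, §4]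
[cite: Mielke1992] -/
theorem hexVec_subset_or_disjoint (hL : 2 ≤ L) (z : TorusSite 2 L) {S : Finset (KagomeFermionVertex L)}
    (hS : cutoff S (hexVec z) ∈ flatBand (univ : Finset (HexTorusVertex L)) (incVec (kagomeEd (L := L)))) :
    (∀ l, hexVec z l ≠ 0 → l ∈ S) ∨ (∀ l, hexVec z l ≠ 0 → l ∉ S) :=
  cycleVec_subset_or_disjoint (kagomeEd_hexCycle z) (hexFace_injective hL z) (hexCycle_injective hL z)
    (by norm_num) hexSign_succ hexSign_ne_zero hS

/-- Neighbouring hexagons `z`, `z + e₀` share the site `(z, 0)`; `z`, `z + e₁` share `(z, 1)`.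
[cite: Tasaki1998PTP, §6.5] -/
private theorem hexVec_overlap_steps (hL : 2 ≤ L) (z : TorusSite 2 L) :
    (∃ l, hexVec z l ≠ 0 ∧ hexVec (z + Pi.single 0 1) l ≠ 0) ∧
      (∃ l, hexVec z l ≠ 0 ∧ hexVec (z + Pi.single 1 1) l ≠ 0) := by
  refine ⟨⟨KagomeFermionVertex.ofKagomeTorusVertex (z, 0), ?_, ?_⟩,
    ⟨KagomeFermionVertex.ofKagomeTorusVertex (z, 1), ?_, ?_⟩⟩
  · simpa [hexSite] using hexVec_apply_hexSite_ne_zero hL z 5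
  · have e : hexSite (z + Pi.single 0 1) 2 = (z, 0) := by simp [hexSite]
    rw [← e]
    exact hexVec_apply_hexSite_ne_zero hL _ 2
  · simpa [hexSite] using hexVec_apply_hexSite_ne_zero hL z 0
  · have e : hexSite (z + Pi.single 1 1) 3 = (z, 1) := by simp [hexSite]
    rw [← e]
    exact hexVec_apply_hexSite_ne_zero hL _ 3

/-- Every kagomé site lies on a hexagon. [cite: Tasaki1998PTP, §6.5] -/
private theorem exists_hexVec_apply_ne_zero (hL : 2 ≤ L) (l : KagomeFermionVertex L) :
    ∃ z : TorusSite 2 L, hexVec z l ≠ 0 := by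
  rw [← KagomeFermionVertex.ofKagomeTorusVertex_toKagomeTorusVertex l]
  generalize KagomeFermionVertex.toKagomeTorusVertex l = b
  obtain ⟨x, s⟩ := b
  fin_cases s
  · exact ⟨x, by simpa [hexSite] using hexVec_apply_hexSite_ne_zero hL x 5⟩
  · exact ⟨x, by simpa [hexSite] using hexVec_apply_hexSite_ne_zero hL x 0⟩
  · have e : hexSite (x + Pi.single 0 1) 1 = (x, 2) := by simp [hexSite]
    refine ⟨x + Pi.single 0 1, ?_⟩
    show hexVec (x + Pi.single 0 1) (KagomeFermionVertex.ofKagomeTorusVertex (x, 2)) ≠ 0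
    rw [← e]
    exact hexVec_apply_hexSite_ne_zero hL _ 1

/-- **Mielke's irreducibility for the kagomé flat band** (`L ≥ 2`): the hexagon states are
indecomposable flat-band vectors covering every site, with connected overlaps.
[cite: Mielke1999, §4] [cite: Mielke1992] [cite: Tasaki1998PTP, §6.5, Theorem 6.2 ("twofold connected")] -/
theorem kagome_flatBand_isIrreducible (hL : 2 ≤ L) :
    IsIrreducible (flatBand (univ : Finset (HexTorusVertex L)) (incVec (kagomeEd (L := L)))) := by
  refine isIrreducible_of_cover (J := TorusSite 2 L) (fun z => hexVec z) ?_ ?_ ?_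
  · intro z S hS
    exact hexVec_subset_or_disjoint hL z (hS _ (hexVec_mem_flatBand hL z))
  · intro z z'
    exact reflTransGen_torusSite (r := fun a b : TorusSite 2 L => ∃ l, hexVec a l ≠ 0 ∧ hexVec b l ≠ 0)
      (fun X => (hexVec_overlap_steps hL X).1) (fun X => (hexVec_overlap_steps hL X).2) z z'
  · intro v _ l _
    exact exists_hexVec_apply_ne_zero hL l

/-! ### The theorem -/

omit [NeZero L] in
/-- **Flat-band ferromagnetism of the Hubbard model on the kagomé torus** [Mielke 1992; Tasaki 1998,
Theorem 6.2]. For `L ≥ 2`, `t > 0`, `U > 0` and `N_e = L² + 1` electrons on the kagomé torus with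
`L × L` unit cells (`3L²` sites; hopping `+t`, i.e. the tree's `hamiltonian (kagomeFermionGraph L) (-t) U`):
the ground-state energy is `-2t (L² + 1)`, every ground state `ψ` has total spin `S = N_e/2`
(`S² ψ = S(S+1) ψ`), and the ground states are non-degenerate apart from the `(2S+1)`-fold spin
degeneracy: the joint eigenspace `{Hψ = E₀ψ, N̂ψ = N_eψ}` has dimension exactly `N_e + 1 = L² + 2`.
[cite: Mielke1992] [cite: Tasaki1998PTP, §6.5, Theorem 6.2] [cite: Mielke1991b] -/
theorem kagome_flatBand_ferromagnetism (hL : 2 ≤ L) {t U : ℝ} (ht : 0 < t) (hU : 0 < U) :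
    groundEnergy (QuantumLattice.hamiltonian (kagomeFermionGraph L) (-t) U) (L ^ 2 + 1) =
        -(2 * t) * ((L : ℝ) ^ 2 + 1) ∧
      (∀ ψ : Fock (Orb (KagomeFermionVertex L)),
        IsGroundState (QuantumLattice.hamiltonian (kagomeFermionGraph L) (-t) U) (L ^ 2 + 1) ψ →
          spinSq *ᵥ ψ =
            (((((L ^ 2 + 1 : ℕ) : ℝ) / 2) * (((L ^ 2 + 1 : ℕ) : ℝ) / 2 + 1) : ℝ) : ℂ) • ψ) ∧
      Module.finrank ℂ ↥(LinearMap.ker (Matrix.toLin'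
          (QuantumLattice.hamiltonian (kagomeFermionGraph L) (-t) U -
            ((groundEnergy (QuantumLattice.hamiltonian (kagomeFermionGraph L) (-t) U) (L ^ 2 + 1) : ℝ) : ℂ) •
              1)) ⊓
        LinearMap.ker (Matrix.toLin' (totalNumber -
          ((L ^ 2 + 1 : ℕ) : ℂ) • (1 : Matrix (Finset (Orb (KagomeFermionVertex L))) _ ℂ)))) =
        L ^ 2 + 2 := by
  haveI : NeZero L := ⟨by omega⟩
  have hN := finrank_kagome_flatBand (L := L) hL
  have hH := lineGraphHamiltonian_kagomeEd (L := L) t U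
  obtain ⟨h1, h2, h3⟩ := lineGraph_flatBand_ferromagnetism (ed := kagomeEd (L := L)) kagomeEd_not_isDiag
    (kagomeEd_injective hL) ht hU (kagome_flatBand_isIrreducible hL)
  rw [hN, hH] at h1 h2 h3
  refine ⟨?_, h2, ?_⟩
  · rw [h1]; push_cast; ring
  · rw [h3]

end FlatBand

end Literature.MathematicalPhysics.QuantumLattice
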